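import Literature.Analysis.Matrix.LogDetMixedDifferenceLocallySummed
import HarnessLib

/-!
# S2β · LINE g18-1 · FOUR-POINT-DECAY — the card-free `Δ² log det` rectangle in PRODUCT FORM: constants per quadrilateral, ONE uniform bound on
# their product (the v11 «DET-REP-B» letter shape)

Cell `ym3-torus` (rung R3: continuum `SU(2)` Yang–Mills on `T³` — NOT `d = 4`, NOT infinite volume, NOT a mass gap, NOT Clay); width copy
`ym3-torus-px19` g10; helper of the crux `stmt-QuantumFields-20520` (`--supports … --as helper`, NOT a proof of it).  Asked for by name: w4-20520 g15
21:31:40Z «px19: (ii) — please type `fourPtDecay_body_of_productRows`».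

WHY (memo `LOCATE-DETREP-DEPTH-SCALING-px19g10.md`).  With the operators BOUND to the objects of record (v11, repair (R1) of the degenerate witness of
CERT 823564eb), the index type of the fluctuation matrices has `≍ L^{3(K−J)}` indices per coarse bond, so NO factor of the bound
`α·ε·β₀·δ·S_d·S_dist·e^{−(θ−θ₂)R} + β₀·η` of ✓`Literature.Analysis.Matrix.abs_fourPt_log_det_le_of_summedProfiles` (p744587) is depth-uniform on its own
(`S ≥ 3·L^{3(K−J)}` in coarse units; `α, β₀ ~ L^{−(K−J)}`, `δ, ε ~ θ_J·L^{−2(K−J)}` in aligned gauges) — only their PRODUCT is (`≍ θ_J²`).  So v11 quantifies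
`α ε δ β₀ η S_d S_dist` PER QUADRILATERAL and imposes ONE uniform constraint on the product.  THIS FILE is the by-name brick for that letter shape:
* ★★`abs_fourPt_log_det_le_of_productRows` — ✓`abs_fourPt_log_det_le_of_summedProfiles`' rows VERBATIM + `α·ε·β₀·δ·S_d·S_dist ≤ B` + `β₀·η ≤ B·e^{−(θ−θ₂)R}` ⟹
  `|Δ² log det M| ≤ 2·B·e^{−(θ−θ₂)R}`;
* ★`abs_fourPt_log_det_le_of_productRows_range₂` — the same over the ALL-POINTWISE edition ✓`…_range₂` (two-profile mixed response `η₀`, range `r`, ball count `V`):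
  `α·(ε V)·β₀·(δ V)·S_d·S_dist ≤ B` + `β₀·η₀·V·S_d ≤ B` ⟹ `≤ 2·B·e^{−(θ−θ₂)R}`;
* ★★`abs_fourPt_logDetPair_le_of_productRows` — the Faddeev–Popov pair: `E := log det N − ½·log det M` with BOTH families in product form (same `B`, `R`, rates) ⟹
  `|Δ² E| ≤ 3·B·e^{−(θ−θ₂)R}` (`2B` from `N`, `½·2B` from `M`).
In the application `B := C·θBal_J²`, `R := tdist_J(b.src, b′.src)`, distances in COARSE units; the organ (BRD ∕ [Balaban1984PropagatorsII] (1.33)) owes the rows and the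
product count, nothing else.

HONEST SCOPE.  Linear algebra over ✓p744587; proves nothing of FOUR-POINT-DECAY ∕ LAPLACE ∕ S2β ∕ the crux 20520; `YM3TorusSU2` NOT proved; the Yang–Mills mass gap (Clay)
NOT proved.  Def-free; default heartbeats.
References: [Balaban1985Variational] CMP 102 (1985) 277, Thm 1 (9)–(10) p. 279; [Balaban1984PropagatorsII] CMP 96 (1984) (1.33); [GlimmJaffe1987] §18.2.
-/

noncomputable section

open Literature.Analysis.Matrix

namespace Summit.QuantumFields.YangMills.Theorems.FluctuationComparisonRegPrIntLS2BetaLogDetProductRows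

variable {n : Type*} [Fintype n] [DecidableEq n]

/-- ★★ **THE RECTANGLE IN PRODUCT FORM.**  The rows of ✓`abs_fourPt_log_det_le_of_summedProfiles` verbatim (C¹ rectangle `M(s,t)` of invertible real matrices;
summed profile rows `hD hE`; Combes–Thomas row `hA`; `hB0`; local sums `hSd hSdi`; ℓ¹ mixed response `hR`; separation `hsep`), the per-quadrilateral constants being
ARBITRARY nonnegative reals, plus ONE bound on their product `α·ε·β₀·δ·S_d·S_dist ≤ B` and `β₀·η ≤ B·e^{−(θ−θ₂)R}` ⟹ `|Δ² log det M| ≤ 2·B·e^{−(θ−θ₂)R}`.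
[cite: Balaban1985Variational, Thm 1 (9)-(10) p. 279] [cite: GlimmJaffe1987, §18.2] -/
theorem abs_fourPt_log_det_le_of_productRows (dist : n → n → ℕ) {M M' : ℝ → ℝ → Matrix n n ℝ}
    (hM : ∀ t s i j, HasDerivAt (fun s => M s t i j) (M' s t i j) s) (hM'c : ∀ t i j, Continuous fun s => M' s t i j)
    (hne : ∀ s t, (M s t).det ≠ 0)
    {α ε δ β₀ η θ θ₂ Sd Sdist B : ℝ} (hα : 0 ≤ α) (hε : 0 ≤ ε) (hδ : 0 ≤ δ) (hβ₀ : 0 ≤ β₀)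
    (hθ₂ : 0 ≤ θ₂) (hθ₂θ : θ₂ ≤ θ) (hSdist0 : 0 ≤ Sdist)
    {d d' : n → ℕ} (hD : ∀ s a, ∑ x, |M' s 1 x a| ≤ δ * Real.exp (-(θ * d a)))
    (hE : ∀ s b, ∑ c, |(M s 1 - M s 0) b c| ≤ ε * Real.exp (-(θ * d' b)))
    {R : ℕ} (hsep : ∀ a b, R ≤ d a + dist a b + d' b)
    (hA : ∀ s a b, |(M s 1)⁻¹ a b| ≤ α * Real.exp (-(θ * dist a b)))
    (hB0 : ∀ s a b, |(M s 0)⁻¹ a b| ≤ β₀)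
    (hSd : ∑ a, Real.exp (-(θ₂ * d a)) ≤ Sd) (hSdi : ∀ a, ∑ b, Real.exp (-(θ₂ * dist a b)) ≤ Sdist)
    (hR : ∀ s, ∑ a, ∑ b, |(M' s 1 - M' s 0) a b| ≤ η)
    (hprod : α * ε * β₀ * δ * Sd * Sdist ≤ B) (hmix : β₀ * η ≤ B * Real.exp (-((θ - θ₂) * R))) :
    |Real.log (M 0 0).det - Real.log (M 1 0).det - (Real.log (M 0 1).det - Real.log (M 1 1).det)|
      ≤ 2 * B * Real.exp (-((θ - θ₂) * R)) := by
  have h := abs_fourPt_log_det_le_of_summedProfiles dist hM hM'c hne hα hε hδ hβ₀ hθ₂ hθ₂θ hSdist0 hD hE hsep hA hB0 hSd hSdi hR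
  have he : 0 ≤ Real.exp (-((θ - θ₂) * R)) := (Real.exp_pos _).le
  have h1 : α * ε * β₀ * δ * Sd * Sdist * Real.exp (-((θ - θ₂) * R)) ≤ B * Real.exp (-((θ - θ₂) * R)) :=
    mul_le_mul_of_nonneg_right hprod he
  calc |Real.log (M 0 0).det - Real.log (M 1 0).det - (Real.log (M 0 1).det - Real.log (M 1 1).det)|
      ≤ α * ε * β₀ * δ * Sd * Sdist * Real.exp (-((θ - θ₂) * R)) + β₀ * η := h
    _ ≤ B * Real.exp (-((θ - θ₂) * R)) + B * Real.exp (-((θ - θ₂) * R)) := add_le_add h1 hmix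
    _ = 2 * B * Real.exp (-((θ - θ₂) * R)) := by ring

/-- ★ **THE ALL-POINTWISE RECTANGLE IN PRODUCT FORM.**  The rows of ✓`abs_fourPt_log_det_le_of_expLocalised_range₂` verbatim (pointwise profiles `hD hE`, two-profile
mixed response `hR` with `η₀`, ranges `r`, ball count `V`, separations `hsep hsep₂`, local sums) plus `α·(ε·V)·β₀·(δ·V)·S_d·S_dist ≤ B` and `β₀·(η₀·V·S_d) ≤ B` ⟹
`|Δ² log det M| ≤ 2·B·e^{−(θ−θ₂)R}`. [cite: Balaban1985Variational, Thm 1 (9)-(10) p. 279] [cite: GlimmJaffe1987, §18.2] -/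
theorem abs_fourPt_log_det_le_of_productRows_range₂ (dist : n → n → ℕ) {M M' : ℝ → ℝ → Matrix n n ℝ}
    (hM : ∀ t s i j, HasDerivAt (fun s => M s t i j) (M' s t i j) s) (hM'c : ∀ t i j, Continuous fun s => M' s t i j)
    (hne : ∀ s t, (M s t).det ≠ 0)
    {α ε δ β₀ η₀ θ θ₂ Sd Sdist B : ℝ} (hα : 0 ≤ α) (hε : 0 ≤ ε) (hδ : 0 ≤ δ) (hβ₀ : 0 ≤ β₀) (hη₀ : 0 ≤ η₀)
    (hθ₂ : 0 ≤ θ₂) (hθ₂θ : θ₂ ≤ θ) (hSdist0 : 0 ≤ Sdist)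
    {d d' : n → ℕ} (hD : ∀ s x a, |M' s 1 x a| ≤ δ * Real.exp (-(θ * d a)))
    (hE : ∀ s b c, |(M s 1 - M s 0) b c| ≤ ε * Real.exp (-(θ * d' b)))
    (hR : ∀ s a b, |(M' s 1 - M' s 0) a b| ≤ η₀ * Real.exp (-(θ * (d a + d' a))))
    {r : ℕ} (hDr : ∀ s x a, M' s 1 x a ≠ 0 → dist x a ≤ r) (hEr : ∀ s b c, (M s 1 - M s 0) b c ≠ 0 → dist b c ≤ r)
    (hRr : ∀ s a b, (M' s 1 - M' s 0) a b ≠ 0 → dist a b ≤ r)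
    {V : ℕ} (hVcol : ∀ a, (Finset.univ.filter fun x => dist x a ≤ r).card ≤ V)
    (hVrow : ∀ b, (Finset.univ.filter fun c => dist b c ≤ r).card ≤ V)
    {R : ℕ} (hsep : ∀ a b, R ≤ d a + dist a b + d' b) (hsep₂ : ∀ a, R ≤ d a + d' a)
    (hA : ∀ s a b, |(M s 1)⁻¹ a b| ≤ α * Real.exp (-(θ * dist a b)))
    (hB0 : ∀ s a b, |(M s 0)⁻¹ a b| ≤ β₀)
    (hSd : ∑ a, Real.exp (-(θ₂ * d a)) ≤ Sd) (hSdi : ∀ a, ∑ b, Real.exp (-(θ₂ * dist a b)) ≤ Sdist)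
    (hprod : α * (ε * V) * β₀ * (δ * V) * Sd * Sdist ≤ B) (hmix : β₀ * (η₀ * V * Sd) ≤ B) :
    |Real.log (M 0 0).det - Real.log (M 1 0).det - (Real.log (M 0 1).det - Real.log (M 1 1).det)|
      ≤ 2 * B * Real.exp (-((θ - θ₂) * R)) := by
  have h := abs_fourPt_log_det_le_of_expLocalised_range₂ dist hM hM'c hne hα hε hδ hβ₀ hη₀ hθ₂ hθ₂θ hSdist0 hD hE hR hDr hEr hRr hVcol hVrow
    hsep hsep₂ hA hB0 hSd hSdi
  have he : 0 ≤ Real.exp (-((θ - θ₂) * R)) := (Real.exp_pos _).le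
  have h1 : α * (ε * V) * β₀ * (δ * V) * Sd * Sdist * Real.exp (-((θ - θ₂) * R)) ≤ B * Real.exp (-((θ - θ₂) * R)) :=
    mul_le_mul_of_nonneg_right hprod he
  have h2 : β₀ * (η₀ * V * Sd * Real.exp (-((θ - θ₂) * R))) ≤ B * Real.exp (-((θ - θ₂) * R)) := by
    calc β₀ * (η₀ * V * Sd * Real.exp (-((θ - θ₂) * R))) = β₀ * (η₀ * V * Sd) * Real.exp (-((θ - θ₂) * R)) := by ring
      _ ≤ B * Real.exp (-((θ - θ₂) * R)) := mul_le_mul_of_nonneg_right hmix he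
  calc |Real.log (M 0 0).det - Real.log (M 1 0).det - (Real.log (M 0 1).det - Real.log (M 1 1).det)|
      ≤ α * (ε * V) * β₀ * (δ * V) * Sd * Sdist * Real.exp (-((θ - θ₂) * R)) +
          β₀ * (η₀ * V * Sd * Real.exp (-((θ - θ₂) * R))) := h
    _ ≤ B * Real.exp (-((θ - θ₂) * R)) + B * Real.exp (-((θ - θ₂) * R)) := add_le_add h1 h2
    _ = 2 * B * Real.exp (-((θ - θ₂) * R)) := by ring

/-- ★★ **THE FADDEEV–POPOV PAIR IN PRODUCT FORM.**  Two C¹ rectangles `M` (the gauge-fixed fluctuation operator) and `N` (the Faddeev–Popov operator), EACH with the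
rows of ✓`abs_fourPt_log_det_le_of_summedProfiles` and the product constraints with the same `B`, rates and separation `R`; then the one-loop exponent
`E(s,t) := log det N(s,t) − ½·log det M(s,t)` has `|Δ² E| ≤ 3·B·e^{−(θ−θ₂)R}`. [cite: Balaban1985Variational, Thm 1 (9)-(10) p. 279] [cite: GlimmJaffe1987, §18.2] -/
theorem abs_fourPt_logDetPair_le_of_productRows (distM : n → n → ℕ) {M M' : ℝ → ℝ → Matrix n n ℝ}
    {m : Type*} [Fintype m] [DecidableEq m] (distN : m → m → ℕ) {N N' : ℝ → ℝ → Matrix m m ℝ}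
    (hM : ∀ t s i j, HasDerivAt (fun s => M s t i j) (M' s t i j) s) (hM'c : ∀ t i j, Continuous fun s => M' s t i j)
    (hMne : ∀ s t, (M s t).det ≠ 0)
    (hN : ∀ t s i j, HasDerivAt (fun s => N s t i j) (N' s t i j) s) (hN'c : ∀ t i j, Continuous fun s => N' s t i j)
    (hNne : ∀ s t, (N s t).det ≠ 0)
    {θ θ₂ B : ℝ} (hθ₂ : 0 ≤ θ₂) (hθ₂θ : θ₂ ≤ θ) {R : ℕ}
    -- `M`'s per-quadrilateral letters
    {αM εM δM βM ηM SdM SdistM : ℝ} (hαM : 0 ≤ αM) (hεM : 0 ≤ εM) (hδM : 0 ≤ δM) (hβM : 0 ≤ βM) (hSdistM : 0 ≤ SdistM)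
    {dM dM' : n → ℕ} (hDM : ∀ s a, ∑ x, |M' s 1 x a| ≤ δM * Real.exp (-(θ * dM a)))
    (hEM : ∀ s b, ∑ c, |(M s 1 - M s 0) b c| ≤ εM * Real.exp (-(θ * dM' b)))
    (hsepM : ∀ a b, R ≤ dM a + distM a b + dM' b)
    (hAM : ∀ s a b, |(M s 1)⁻¹ a b| ≤ αM * Real.exp (-(θ * distM a b))) (hB0M : ∀ s a b, |(M s 0)⁻¹ a b| ≤ βM)
    (hSdM : ∑ a, Real.exp (-(θ₂ * dM a)) ≤ SdM) (hSdiM : ∀ a, ∑ b, Real.exp (-(θ₂ * distM a b)) ≤ SdistM)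
    (hRM : ∀ s, ∑ a, ∑ b, |(M' s 1 - M' s 0) a b| ≤ ηM)
    (hprodM : αM * εM * βM * δM * SdM * SdistM ≤ B) (hmixM : βM * ηM ≤ B * Real.exp (-((θ - θ₂) * R)))
    -- `N`'s per-quadrilateral letters
    {αN εN δN βN ηN SdN SdistN : ℝ} (hαN : 0 ≤ αN) (hεN : 0 ≤ εN) (hδN : 0 ≤ δN) (hβN : 0 ≤ βN) (hSdistN : 0 ≤ SdistN)
    {dN dN' : m → ℕ} (hDN : ∀ s a, ∑ x, |N' s 1 x a| ≤ δN * Real.exp (-(θ * dN a)))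
    (hEN : ∀ s b, ∑ c, |(N s 1 - N s 0) b c| ≤ εN * Real.exp (-(θ * dN' b)))
    (hsepN : ∀ a b, R ≤ dN a + distN a b + dN' b)
    (hAN : ∀ s a b, |(N s 1)⁻¹ a b| ≤ αN * Real.exp (-(θ * distN a b))) (hB0N : ∀ s a b, |(N s 0)⁻¹ a b| ≤ βN)
    (hSdN : ∑ a, Real.exp (-(θ₂ * dN a)) ≤ SdN) (hSdiN : ∀ a, ∑ b, Real.exp (-(θ₂ * distN a b)) ≤ SdistN)
    (hRN : ∀ s, ∑ a, ∑ b, |(N' s 1 - N' s 0) a b| ≤ ηN)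
    (hprodN : αN * εN * βN * δN * SdN * SdistN ≤ B) (hmixN : βN * ηN ≤ B * Real.exp (-((θ - θ₂) * R))) :
    |(Real.log (N 0 0).det - (1 / 2) * Real.log (M 0 0).det) - (Real.log (N 1 0).det - (1 / 2) * Real.log (M 1 0).det)
        - ((Real.log (N 0 1).det - (1 / 2) * Real.log (M 0 1).det) - (Real.log (N 1 1).det - (1 / 2) * Real.log (M 1 1).det))|
      ≤ 3 * B * Real.exp (-((θ - θ₂) * R)) := by
  have hMb := abs_fourPt_log_det_le_of_productRows distM hM hM'c hMne hαM hεM hδM hβM hθ₂ hθ₂θ hSdistM hDM hEM hsepM hAM hB0M hSdM hSdiM hRM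
    hprodM hmixM
  have hNb := abs_fourPt_log_det_le_of_productRows distN hN hN'c hNne hαN hεN hδN hβN hθ₂ hθ₂θ hSdistN hDN hEN hsepN hAN hB0N hSdN hSdiN hRN
    hprodN hmixN
  set e := Real.exp (-((θ - θ₂) * R)) with he
  set dM4 := Real.log (M 0 0).det - Real.log (M 1 0).det - (Real.log (M 0 1).det - Real.log (M 1 1).det) with hdM4
  set dN4 := Real.log (N 0 0).det - Real.log (N 1 0).det - (Real.log (N 0 1).det - Real.log (N 1 1).det) with hdN4
  have hsplit : (Real.log (N 0 0).det - (1 / 2) * Real.log (M 0 0).det) - (Real.log (N 1 0).det - (1 / 2) * Real.log (M 1 0).det)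
        - ((Real.log (N 0 1).det - (1 / 2) * Real.log (M 0 1).det) - (Real.log (N 1 1).det - (1 / 2) * Real.log (M 1 1).det))
      = dN4 - (1 / 2) * dM4 := by
    rw [hdM4, hdN4]; ring
  rw [hsplit]
  calc |dN4 - (1 / 2) * dM4| ≤ |dN4| + |(1 / 2) * dM4| := abs_sub _ _
    _ = |dN4| + (1 / 2) * |dM4| := by rw [abs_mul, abs_of_pos (by norm_num : (0 : ℝ) < 1 / 2)]
    _ ≤ 2 * B * e + (1 / 2) * (2 * B * e) := add_le_add hNb (mul_le_mul_of_nonneg_left hMb (by norm_num))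
    _ = 3 * B * e := by ring

end Summit.QuantumFields.YangMills.Theorems.FluctuationComparisonRegPrIntLS2BetaLogDetProductRows

end
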